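import Summits.HodgeConjecture.HodgeConjecture.Theorems.Ring2AbelianAllWeilSymmetrisedDescent
import Summits.HodgeConjecture.HodgeConjecture.Theorems.Ring2AbelianAllWeilHyperbolicRungs
import Summits.HodgeConjecture.HodgeConjecture.Theorems.Ring2AbelianAllWeilComponentsDescent
import HarnessLib

/-!
# Ring 2 · AbelianAll (ab-weil-1, gen 137) — the print obligation `HyperplanePullbackAlongIsogeny`
  ERASED from the split slices, the named split rungs and the δ-cells

research route, not a corollary; conditional on HC_CM plus one named minimal statement.
Cell line: research route conditional on HC_CM; not a corollary; Q11.4-sentence-2 already refuted in dim ≥ 3.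
`HC_CM` (`Theses.RankFourFaces.CMAbelianHodge`) does not occur in this file. No case of the Hodge
conjecture is claimed: every statement below is an IMPLICATION or EQUIVALENCE between open statements.

Gens 5–7 re-indexed the Weil-type ladder by the Weil FIELD `K = ℚ(√-d)` (squarefree `d`) MODULO the typed
print obligation `HyperplanePullbackAlongIsogeny` (`H_amp`: the pull-back of a hyperplane class along an
isogeny is a non-zero rational multiple of a hyperplane class — first Chern classes / ampleness, absent from
the tree). The sequel of `Ring2AbelianAllWeilSymmetrisedDescent` (`exists_symmetrisedDescent`: a projective
embedding of the descended variety `B ⊂ A × A` whose `K`-SYMMETRISED hyperplane class is a non-zero rational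
multiple of the symmetrised class of `f^*(e^*a)`) erases `H_amp` from every use in which only the
symmetrised class matters — which is all of them except one:

* §3 the SPLIT slices `WeilAlgebraicSplitHyperplane n d`: upward transport `d ⟹ m²d`
  (`weilAlgebraicSplitHyperplane_sq_mul'`), `(∀ d) ↔ (∀ squarefree d)`, the square class `m²d ↔ d`, and the
  named rungs R2₈ `SplitEightfolds`, R2 `SplitWeilAbelianVarieties`, F2 (Markman's split-sixfold statement, a
  `def`, never asserted) `↔` their squarefree slices; the refereed `ℚ(i)` / `ℚ(√-3)` square towers on the
  split sixfold slices from Koike 2004 / Schoen 1998 ALONE (named facts, as hypotheses);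
* §3′ the δ-CELLS `WeilClassesComponent n d δ`, every class `δ` split or not: `(n, d, congr δ) ⟹ (n, m²d, δ)`
  (`weilClassesComponent_sq_mul'`), the cell / row / table equivalences, the split column and the non-split
  cells by squarefree `d`, and the fourfold residual R1 ↔ R1′ granted only Koike and Schoen.

NOT erased: the non-split slice in the formulation `WeilAlgebraicNonsplitHyperplane` (gen 5,
`weilAlgebraicNonsplitHyperplane_sq_mul H`), which quantifies over ALL hyperplane classes of the variety;
`H_amp` itself is neither proved nor refuted.

## References
* D. Mumford, *Abelian Varieties* (1970), §19 Thm. 3 and p. 173. [MumfordAV1970]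
* B. van Geemen, LNM 1594 (1994), Lemma 5.2 (3), 4.14, 5.4, 5.6. [vanGeemen1994HodgeAV]
* B. Moonen, Yu. Zarhin, Crelle 496 (1998), §1. [MoonenZarhin1998WeilClasses]
* E. Markman, arXiv:2502.03415, Thm. 1.5.1, §1.2. [Markman2025SecantWeil]
* E. Markman, arXiv:2509.23403, §12. [Markman2025SurveySecant]
* K. Koike, Canad. Math. Bull. 47 (2004), Cor. 2.1, Rem. 2.1. [Koike2004WeilHodge]
* C. Schoen, Compositio Math. 114 (1998), §10 and Theorem p. 329. [Schoen1998HodgeWeilAddendum]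
-/

noncomputable section

set_option linter.dupNamespace false

open CategoryTheory AlgebraicGeometry
open Literature.AlgebraicGeometry Literature.AlgebraicGeometry.Motives
open Literature.AlgebraicGeometry.HodgeTheory
open Literature.AlgebraicGeometry.VanGeemen1994
open Literature.AlgebraicTopology.SingularHomology
open Summit.HodgeConjecture.HodgeConjecture.Cruxes.HodgeAbelianVarieties.EStepSecantInduction
open Summit.HodgeConjecture.HodgeConjecture.WeilTypeLadder
open Summit.HodgeConjecture.HodgeConjecture.Ring2.Hypotheses
open Summit.HodgeConjecture.HodgeConjecture.Ring2.Habitat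

namespace Summit.HodgeConjecture.HodgeConjecture.Ring2.AbelianAll

/-! ### §3 The print obligation discharged: the split slices -/

/-- **UPWARD, NOW FREE of `HyperplanePullbackAlongIsogeny`: the split slice at `(n, d)` implies the split
slice at `(n, m²d)`** (`m ≥ 1`). As gen 5's `weilAlgebraicSplitHyperplane_sq_mul`, with the hyperplane class of
`B` supplied by `exists_symmetrisedDescent` instead of the print obligation: `(B, ψ)` is hyperbolic for
`d·y + ψ^*y`, `y = f^*e^*a`, hence for its non-zero rational multiple `d·e'^*a' + ψ^*e'^*a'`.
[cite: vanGeemen1994HodgeAV, Lemma 5.2 (3)] [cite: MumfordAV1970, §19 Thm. 3 and p. 173] -/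
theorem weilAlgebraicSplitHyperplane_sq_mul' {n m d : ℕ} (hm : m ≠ 0)
    (hW : Stubs.WeilAlgebraicSplitHyperplane n d) : Stubs.WeilAlgebraicSplitHyperplane n (m ^ 2 * d) := by
  rcases Nat.eq_zero_or_pos d with rfl | hd
  · simpa using hW
  intro A φ' e a hA hφ' ha ha0 hhyp c' hc'W hrat hhodge
  obtain ⟨B, p, f, ψ, hp, hfi, hf, -, hψ, hfφ, -, e', a', c, ha', ha'0, hc, he'⟩ :=
    exists_symmetrisedDescent hm hd hφ' e a ha ha0
  have hB : B.dim = 2 * n := (AbelianVariety.dim_eq_of_isIsogenous_holds ⟨p, hp⟩).symm.trans hA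
  have h₁ := (isHyperbolicWeilType_iff_of_isIsogeny hfi hfφ).1 hhyp
  rw [map_symmetrised_of_comm f hfφ, symmetrised_natCast_zsmul,
    isHyperbolicWeilType_smul_iff (pow_ne_zero 2 (Nat.cast_ne_zero.mpr hm)),
    isHyperbolicWeilType_natCast_zsmul_iff hm] at h₁
  have h₂ : IsHyperbolicWeilType B ψ n ((d : ℂ) • complexBetti.map e'.ι 2 a' +
      complexBetti.map ψ.hom.hom.hom 2 (complexBetti.map e'.ι 2 a')) := by
    rw [he']
    exact (isHyperbolicWeilType_smul_iff (by exact_mod_cast hc)).2 h₁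
  exact weilAlgebraicFor_of_descent hm hd.ne' hA hp hf hψ hfφ (hW B ψ e' a' hB hψ ha' ha'0 h₂)
    c' hc'W hrat hhodge

/-- **Squarefree `d` suffice on the split slices — unconditionally** (`d = b²a`).
[cite: MoonenZarhin1998WeilClasses, §1] -/
theorem forall_weilAlgebraicSplitHyperplane_iff_squarefree' (n : ℕ) :
    (∀ d : ℕ, 0 < d → Stubs.WeilAlgebraicSplitHyperplane n d) ↔
      ∀ d : ℕ, 0 < d → Squarefree d → Stubs.WeilAlgebraicSplitHyperplane n d := by
  refine ⟨fun h d hd _ => h d hd, fun h d hd => ?_⟩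
  obtain ⟨a, b, ha, hb, rfl, hsq⟩ := Nat.sq_mul_squarefree_of_pos hd
  exact weilAlgebraicSplitHyperplane_sq_mul' hb.ne' (h a ha hsq)

/-- **The split slice at `(n, m²d)` IS the split slice at `(n, d)`** (`m ≥ 1`), both ways free: the split
`d`-slices are indexed by the Weil FIELD `K = ℚ(√-d)`. [cite: MoonenZarhin1998WeilClasses, §1] -/
theorem weilAlgebraicSplitHyperplane_sq_class_iff' {n m d : ℕ} (hm : m ≠ 0) :
    Stubs.WeilAlgebraicSplitHyperplane n (m ^ 2 * d) ↔ Stubs.WeilAlgebraicSplitHyperplane n d :=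
  ⟨weilAlgebraicSplitHyperplane_of_sq_mul hm, weilAlgebraicSplitHyperplane_sq_mul' hm⟩

/-- **R2₈: `SplitEightfolds ↔` its squarefree slices, unconditionally.** OPEN on both sides; no case of HC
is claimed. [cite: Markman2025SecantWeil, §1.2] [cite: MoonenZarhin1998WeilClasses, §1] -/
theorem splitEightfolds_iff_squarefree' :
    SplitEightfolds ↔ ∀ d : ℕ, 0 < d → Squarefree d → Stubs.WeilAlgebraicSplitHyperplane 4 d := by
  rw [splitEightfolds_iff_forall_splitHyperplane, forall_weilAlgebraicSplitHyperplane_iff_squarefree']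

/-- **R2: `SplitWeilAbelianVarieties ↔` its squarefree slices (`n ≥ 4`), unconditionally.**
[cite: Markman2025SurveySecant, §12] [cite: MoonenZarhin1998WeilClasses, §1] -/
theorem splitWeilAbelianVarieties_iff_squarefree' :
    SplitWeilAbelianVarieties ↔
      ∀ n : ℕ, 4 ≤ n → ∀ d : ℕ, 0 < d → Squarefree d → Stubs.WeilAlgebraicSplitHyperplane n d := by
  rw [splitWeilAbelianVarieties_iff_forall_splitHyperplane]
  exact forall_congr' fun n => forall_congr' fun _ => forall_weilAlgebraicSplitHyperplane_iff_squarefree' n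

/-- **F2: Markman's split-sixfold STATEMENT (a `def`, preprint, UNREFEREED, never asserted) `↔` its
squarefree slices, unconditionally.** [cite: Markman2025SecantWeil, Thm. 1.5.1] [cite: MoonenZarhin1998WeilClasses, §1] -/
theorem markmanHyperbolicSixfold_iff_squarefree' :
    Markman2025_weilClasses_algebraic_hyperbolicSixfold ↔
      ∀ d : ℕ, 0 < d → Squarefree d → Stubs.WeilAlgebraicSplitHyperplane 3 d := by
  rw [← Stubs.weilAlgebraicSplitHyperplane_three_iff_markman, forall_weilAlgebraicSplitHyperplane_iff_squarefree']

/-- **The refereed `ℚ(i)` column goes up the squares on the split sixfold slices, unconditionally**: the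
slices `(3, m²)` follow from Koike's theorem (a named fact, taken as a hypothesis).
[cite: Koike2004WeilHodge, Cor. 2.1 and Rem. 2.1] [cite: MumfordAV1970, §19 Thm. 3] -/
theorem weilAlgebraicSplitHyperplane_three_sq_of_koike2004'
    (hK : Koike2004_weilClasses_algebraic_hyperbolicSixfold_one) {m : ℕ} (hm : m ≠ 0) :
    Stubs.WeilAlgebraicSplitHyperplane 3 (m ^ 2) := by
  simpa using weilAlgebraicSplitHyperplane_sq_mul' hm (d := 1)
    (weilAlgebraicSplitHyperplane_three_one_of_koike2004 hK)

/-- **The refereed `ℚ(√-3)` column on the split sixfold slices, unconditionally**: the slices `(3, 3m²)`.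
[cite: Schoen1998HodgeWeilAddendum, Theorem (p. 329)] [cite: MumfordAV1970, §19 Thm. 3] -/
theorem weilAlgebraicSplitHyperplane_three_sq_mul_three_of_schoen1998'
    (hS : Schoen1998_weilClasses_algebraic_hyperbolicSixfold_three) {m : ℕ} (hm : m ≠ 0) :
    Stubs.WeilAlgebraicSplitHyperplane 3 (m ^ 2 * 3) :=
  weilAlgebraicSplitHyperplane_sq_mul' hm (weilAlgebraicSplitHyperplane_three_three_of_schoen1998 hS)

/-- The three SPLIT rungs of `WeilTypeLadder` are statements about squarefree `d` only — unconditionally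
(gen 5's `hyperbolicRungs_iff_squarefree` minus its hypothesis `H`, on the split rungs). [folklore] -/
theorem splitRungs_iff_squarefree :
    (SplitEightfolds ↔ ∀ d : ℕ, 0 < d → Squarefree d → Stubs.WeilAlgebraicSplitHyperplane 4 d) ∧
      (SplitWeilAbelianVarieties ↔
        ∀ n : ℕ, 4 ≤ n → ∀ d : ℕ, 0 < d → Squarefree d → Stubs.WeilAlgebraicSplitHyperplane n d) ∧
      (Markman2025_weilClasses_algebraic_hyperbolicSixfold ↔
        ∀ d : ℕ, 0 < d → Squarefree d → Stubs.WeilAlgebraicSplitHyperplane 3 d) :=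
  ⟨splitEightfolds_iff_squarefree', splitWeilAbelianVarieties_iff_squarefree', markmanHyperbolicSixfold_iff_squarefree'⟩

/-! ### §3′ The print obligation discharged: the cells of the δ-table -/

/-- **UPWARD, NOW FREE: the cell `(n, d, congr δ)` implies the cell `(n, m²d, δ)`** (`m, d ≥ 1`) — every
class `δ`, split or not. As gen 6's `weilClassesComponent_sq_mul`, with `exists_symmetrisedDescent` for the
print obligation: `d·y + ψ^*y` (`y = f^*e^*a`) has class `congr δ`, hence so has its non-zero rational multiple
`d·e'^*a' + ψ^*e'^*a'`. [cite: vanGeemen1994HodgeAV, Lemma 5.2 (3) and 4.14] [cite: MumfordAV1970, §19 Thm. 3] -/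
theorem weilClassesComponent_sq_mul' {n m d : ℕ} (hm : m ≠ 0) (hd : 0 < d) {δ : weilNormResidueGroup (m ^ 2 * d)}
    (hW : WeilClassesComponent n d (weilNormResidueGroupCongr hm d δ)) : WeilClassesComponent n (m ^ 2 * d) δ := by
  intro A φ' hA hX hφ' e a ha ha0 hdisc c' hrat hhodge hc'W
  obtain ⟨B, p, f, ψ, hp, hfi, hf, -, hψ, hfφ, -, e', a', c, ha', ha'0, hc, he'⟩ :=
    exists_symmetrisedDescent hm hd hφ' e a ha ha0
  have hB : B.dim = 2 * n := (AbelianVariety.dim_eq_of_isIsogenous_holds ⟨p, hp⟩).symm.trans hA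
  have h₁ := (hasWeilDiscriminantNondeg_iff_of_isIsogeny hfi hfφ).1 hdisc
  rw [map_symmetrised_of_comm f hfφ, hasWeilDiscriminantNondeg_symmetrised_natCast_zsmul_iff hm] at h₁
  have h₂ : HasWeilDiscriminantNondeg B ψ n d ((d : ℂ) • complexBetti.map e'.ι 2 a' +
      complexBetti.map ψ.hom.hom.hom 2 (complexBetti.map e'.ι 2 a')) (weilNormResidueGroupCongr hm d δ) := by
    rw [he']
    exact (hasWeilDiscriminantNondeg_ratCast_smul_iff hc).2 h₁
  have hWB : WeilAlgebraicFor n d B ψ := fun c hcW hrat hhodge =>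
    hW B ψ hB (isSmoothProjective_of_dim_eq' hB) hψ e' a' ha' ha'0 h₂ c hrat hhodge hcW
  exact weilAlgebraicFor_of_descent hm hd.ne' hA hp hf hψ hfφ hWB c' hc'W hrat hhodge

/-- **The cell `(n, m²d, δ)` IS the cell `(n, d, congr δ)`, unconditionally** (`m, d ≥ 1`): the typed δ-table is
indexed by `(n, K = ℚ(√-d), det H)`, van Geemen's and Markman's habitat. [cite: vanGeemen1994HodgeAV, 4.14 and Lemma 5.2 (3)] -/
theorem weilClassesComponent_sq_class_iff' {n m d : ℕ} (hm : m ≠ 0) (hd : 0 < d)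
    {δ : weilNormResidueGroup (m ^ 2 * d)} :
    WeilClassesComponent n (m ^ 2 * d) δ ↔ WeilClassesComponent n d (weilNormResidueGroupCongr hm d δ) :=
  ⟨weilClassesComponent_of_sq_mul hm hd, weilClassesComponent_sq_mul' hm hd⟩

/-- The `(n, m²d)`-row of the δ-table ↔ the `(n, d)`-row, unconditionally. [cite: vanGeemen1994HodgeAV, Lemma 5.2 (3)] -/
theorem forall_weilClassesComponent_sq_class_iff' {n m d : ℕ} (hm : m ≠ 0) (hd : 0 < d) :
    (∀ δ : weilNormResidueGroup (m ^ 2 * d), WeilClassesComponent n (m ^ 2 * d) δ) ↔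
      ∀ δ' : weilNormResidueGroup d, WeilClassesComponent n d δ' :=
  ⟨forall_weilClassesComponent_of_sq_mul hm hd, fun h _ => weilClassesComponent_sq_mul' hm hd (h _)⟩

/-- **`WeilClassesByComponent` needs squarefree `d` only, unconditionally** (`d = b²a`).
[cite: vanGeemen1994HodgeAV, Lemma 5.2 (3)] [cite: MoonenZarhin1998WeilClasses, §1] -/
theorem weilClassesByComponent_iff_squarefree' :
    WeilClassesByComponent ↔
      ∀ (n : ℕ), 2 ≤ n → ∀ (d : ℕ), 0 < d → Squarefree d →
        ∀ δ : weilNormResidueGroup d, WeilClassesComponent n d δ := by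
  refine ⟨fun h n hn d hd _ δ => h n hn d hd δ, fun h n hn d hd δ => ?_⟩
  obtain ⟨a, b, ha, hb, rfl, hsq⟩ := Nat.sq_mul_squarefree_of_pos hd
  exact weilClassesComponent_sq_mul' hb.ne' ha (h n hn a ha hsq _)

/-- The SPLIT cell `(n, m²d, (-1)ⁿ)` ↔ the split cell `(n, d, (-1)ⁿ)`, unconditionally.
[cite: vanGeemen1994HodgeAV, 5.4 and (5.4.1)] -/
theorem weilClassesComponent_split_sq_class_iff' {n m d : ℕ} (hm : m ≠ 0) (hd : 0 < d) :
    WeilClassesComponent n (m ^ 2 * d) (splitDiscriminantClass n (m ^ 2 * d)) ↔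
      WeilClassesComponent n d (splitDiscriminantClass n d) := by
  rw [weilClassesComponent_sq_class_iff' hm hd, weilNormResidueGroupCongr_splitDiscriminantClass]

/-- **The split column by squarefree `d`, unconditionally.** [cite: vanGeemen1994HodgeAV, (5.4.1)]
[cite: MoonenZarhin1998WeilClasses, §1] -/
theorem forall_split_components_iff_squarefree' (P : ℕ → Prop) :
    (∀ (n : ℕ), P n → ∀ (d : ℕ), 0 < d → WeilClassesComponent n d (splitDiscriminantClass n d)) ↔
      ∀ (n : ℕ), P n → ∀ (d : ℕ), 0 < d → Squarefree d →
        WeilClassesComponent n d (splitDiscriminantClass n d) := by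
  refine ⟨fun h n hn d hd _ => h n hn d hd, fun h n hn d hd => ?_⟩
  obtain ⟨a, b, ha, hb, rfl, hsq⟩ := Nat.sq_mul_squarefree_of_pos hd
  exact (weilClassesComponent_split_sq_class_iff' hb.ne' ha).2 (h n hn a ha hsq)

/-- **The NON-SPLIT cells by squarefree `d`, class by class, unconditionally** — for `n = 3` the hypothesis of
the rung R1′ `NonsplitSixfolds` by components. (The formulation `WeilAlgebraicNonsplitHyperplane` of gen 5,
which quantifies over ALL hyperplane classes of the variety, is NOT discharged here: its upward transport
needs a hyperplane class of `A` through `p : A → B`, which has a kernel.) [cite: vanGeemen1994HodgeAV, Lemma 5.2 (3) and 5.6]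
[cite: MoonenZarhin1998WeilClasses, §1] -/
theorem forall_nonsplit_components_iff_squarefree' (n : ℕ) :
    (∀ (d : ℕ), 0 < d → ∀ δ : weilNormResidueGroup d, δ ≠ splitDiscriminantClass n d →
        WeilClassesComponent n d δ) ↔
      ∀ (d : ℕ), 0 < d → Squarefree d → ∀ δ : weilNormResidueGroup d, δ ≠ splitDiscriminantClass n d →
        WeilClassesComponent n d δ := by
  refine ⟨fun h d hd _ => h d hd, fun h d hd δ hδ => ?_⟩
  obtain ⟨a, b, ha, hb, rfl, hsq⟩ := Nat.sq_mul_squarefree_of_pos hd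
  exact weilClassesComponent_sq_mul' hb.ne' ha
    (h a ha hsq _ fun hs => hδ ((weilNormResidueGroupCongr_eq_split_iff hb.ne').1 hs))

/-- **R1 ↔ R1′ for the fourfold residual, minus the print obligation**: the residual over all `d ∉ {1, 3}`
follows from the residual over squarefree `d ∉ {1, 3}` and the refereed sixfold facts of Koike (`d₀ = 1`) and
Schoen (`d₀ = 3`) (named facts, taken as hypotheses; nothing asserted). [cite: Koike2004WeilHodge, Rem. 2.1]
[cite: Schoen1998HodgeWeilAddendum, §10] [cite: vanGeemen1994HodgeAV, Lemma 5.2 (3)] -/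
theorem weilFourfoldResidual_of_residualSq' (hK : Koike2004_weilClasses_algebraic_hyperbolicSixfold_one)
    (hS : Schoen1998_weilClasses_algebraic_hyperbolicSixfold_three) (hR : WeilFourfoldResidualSq) :
    WeilFourfoldResidual := by
  intro d hd h1 h3 δ hδ
  obtain ⟨a, b, ha, hb, rfl, hsq⟩ := Nat.sq_mul_squarefree_of_pos hd
  by_cases ha1 : a = 1
  · subst ha1
    exact weilClassesComponent_two_sq_mul_of_weilAlgebraicAll hb.ne' (weilAlgebraicAll_two_of_floorSlice one_pos hK) δ
  by_cases ha3 : a = 3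
  · subst ha3
    exact weilClassesComponent_two_sq_mul_of_weilAlgebraicAll hb.ne'
      (weilAlgebraicAll_two_of_floorSlice (by norm_num) hS) δ
  exact weilClassesComponent_sq_mul' hb.ne' ha
    (hR a ha hsq ha1 ha3 _ fun hs => hδ ((weilNormResidueGroupCongr_eq_split_iff hb.ne').1 hs))

/-- **R1 ↔ R1′**, granted only the refereed facts of Koike and Schoen (hypotheses). [cite: Koike2004WeilHodge, Rem. 2.1]
[cite: Schoen1998HodgeWeilAddendum, §10] -/
theorem weilFourfoldResidual_iff_residualSq' (hK : Koike2004_weilClasses_algebraic_hyperbolicSixfold_one)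
    (hS : Schoen1998_weilClasses_algebraic_hyperbolicSixfold_three) :
    WeilFourfoldResidual ↔ WeilFourfoldResidualSq :=
  ⟨weilFourfoldResidualSq_of_weilFourfoldResidual, weilFourfoldResidual_of_residualSq' hK hS⟩

/-- **The print obligation implies nothing new on these statements**: every `H`-conditional transport of gens
5–6 on the split slices and on the δ-cells now holds with `H` erased (recorded as the trivial implication from
the unconditional versions; `H` itself — a statement about ONE hyperplane class `c·f^*e^*a` — is neither proved
nor refuted here). [folklore] -/
theorem hyperplanePullbackAlongIsogeny_uses_discharged :
    (∀ {n m d : ℕ}, m ≠ 0 → Stubs.WeilAlgebraicSplitHyperplane n d → Stubs.WeilAlgebraicSplitHyperplane n (m ^ 2 * d)) ∧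
      (∀ {n m d : ℕ} (hm : m ≠ 0), 0 < d → ∀ {δ : weilNormResidueGroup (m ^ 2 * d)},
        WeilClassesComponent n d (weilNormResidueGroupCongr hm d δ) → WeilClassesComponent n (m ^ 2 * d) δ) :=
  ⟨fun hm hW => weilAlgebraicSplitHyperplane_sq_mul' hm hW, fun hm hd _ hW => weilClassesComponent_sq_mul' hm hd hW⟩


end Summit.HodgeConjecture.HodgeConjecture.Ring2.AbelianAll

end
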